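import Summits.QuantumFields.YangMills.Theorems.BalabanUVNodesN08TrivialHistoryIteratedTransport

/-!
# BalabanUVNodes ∕ N08 — THE HISTORY-EXTENSIVE MASS LETTER, V: SUFFICIENCY UP TO `log(k+1)` — if ALL partial iterated push-forwards of the reference measure obey
# `(Ū_{k−1}∘⋯∘Ū_j)_*dU_j ≤ C_k·dU_k` (`j ≤ k ≤ K̄`), then `m_k(h,·) ≤ 1 + k·C_k` `dU_k`-a.e. FOR EVERY HISTORY; with file 25's necessity this brackets N08's transport residual
# between (a)′ (start level 0) and (a)′∀ (all start levels), the floor of the (47)-term costing at most the factor `k + 1`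

Track A, DAG node N08 = T. Bałaban, CMP **102** (1985) 255–275 [Balaban1985UV3]: (41) p. 266 (the history masses), (2) p. 256, (5) p. 257; [Balaban1985Averaging] (10) + (15) p. 19.
Cell `pub-ymgap`, width seat `pub-ymgap-dag-n08-w1` (g5), W-SEAT-START-LIST §n08 item 1 successor piece (o22) = file 27; `--supports` K1⁹ `StabilityBRunRowsAtRecordR13SepCoPHV`
(stmt-QuantumFields-27364, KEY MAP v2; helper).  Imports file 25 (`…N08TrivialHistoryIteratedTransport`: NECESSITY of (a)′, the exact transport); uses file 16∕17's closed-family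
reductions (`…N08MassesACDominated`, `…N08MassesACLeastClosedFamily`).

THE POINT.  File 25: every a.e. mass letter forces (a)′ «`(Ū_{k−1}∘⋯∘Ū_0)_*dU_0 ≤ e^{c_m|T₁^{(k)}|}·dU_k`».  Conversely — THIS FILE — the same bound for ALL START LEVELS `j`,
(a)′∀ «`ι_{j,k} := (Ū_{k−1}∘⋯∘Ū_j)_*dU_j ≤ C_k·dU_k`, `j ≤ k ≤ K̄`», already gives the UNIFORM letter up to a factor `k + 1`, for EVERY history (not only the trivial one): the
family `ν_k := Σ_{j<k} ι_{j,k}` is strongly closed WITH EQUALITY, `(dU_k + ν_k)∘Ū_k⁻¹ = ν_{k+1}`, so files 16∕17 give `m_k(h,·)·dU_k ≤ Σ_{j≤k} ι_{j,k} ≤ (1 + k·C_k)·dU_k`.  Hence, in the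
AC lane's bookkeeping, N08's transport residual IS the iterated-Haar-push-forward question, bracketed: (a)′ ⟸ hmass ⟸ (a)′∀ − log(k+1); the step weights `ζχ` only help, and the
history-extensive budget of files 23–24 is extra room on top.  The factor `k + 1` is the price of the floor `max 1 (…)` of the (47)-term (one reference copy per level); at the
[B10] slot it is a `log(K+1)` defect at the top levels only (there `|T₁^{(k)}|` no longer dominates `log k`) — located, not resolved here.

WHAT THIS FILE PROVES (kernel; theorems only, 0 def; [folklore] measure theory; nothing of the paper asserted).  Any averaging family with `AvgAC`.
* §1 `map_finset_sum` (push-forward of a finite sum of measures); ★ `exists_partialIterates` — THE PARTIAL ITERATED PUSH-FORWARDS EXIST as a two-parameter family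
  `ι : ∀ j k, Measure` with `ι_{j,j} = dU_j`, `ι_{j,k+1} = ι_{j,k}∘Ū_k⁻¹` (`j ≤ k`) (recursion; no definition introduced); `partialIterates_zero_eq_withDensity_rhoSeq` — the start-level-0
  member IS file 25's `(T_{k−1}⋯T_0 1)·dU_k`.
* §2 ★★★ `massRecAC_le_ae_of_partialIterates_le` — **(a)′∀ ⇒ `m_k(h,·) ≤ 1 + k·C_k` `dU_k`-a.e., every `k ≤ K̄`, EVERY history** (`C_k ≥ 0` real; hypotheses only on `ι_{j,k}` for
  `j < k ≤ K̄`); ★★ `massRecAC_le_exp_mul_ae_of_partialIterates_le` — with `C_k = e^{c_k}`, `c_k ≥ 0`: `m_k(h,·) ≤ (k+1)·e^{c_k} = exp(c_k + log(k+1))`.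
* §3 at print's averaging `avOfPrint N S` on `SU(N)`: ★★★ `massRecAC_avOfPrint_le_ae_of_partialIterates_le` — «all partial iterated push-forwards of Haar under (15) are
  `≤ e^{c_m|T₁^{(k)}|}·dU_k`» ⇒ «`massRecAC … (avOfPrint N S) k h ≤ (k+1)·e^{c_m|T₁^{(k)}|}` a.e.», every history, `k ≤ K`.

LOCATED READING (R4⁹) (count-neutral; owners decide).  N08's E6′-replacement in the AC lane is now BRACKETED in the kernel by statements about ITERATED PUSH-FORWARDS OF HAAR
ALONE (no histories, no weights, no Z-terms): necessary (a)′ (file 25) — sufficient (a)′∀ up to `log(k+1)` (this file); the history-extensive Z-budget (files 23–24) and the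
history-indexed currency (file 26) are the extra room.  What the analysis lineage (n08-w3∕w6, pub-balaban3d) has to produce is therefore exactly: `(Ū_{k−1}∘⋯∘Ū_j)_*dU_j ≤
e^{c|T₁^{(k)}|}·dU_k` uniformly in `j ≤ k ≤ K` — their one-step `Ū_*(dU) ≤ D·dV` is `k = j + 1` — plus, for the printed letter without the `log(K+1)` defect, a no-stacking statement for
the floors at the top levels.  Nothing here decides (a)′∀.

HONEST FRAMING: count-neutral helper; (a)′∀ NOT decided; E6′ neither used nor decided; `PrintedUV3V` NOT proved; N08 NOT discharged; one finite 𝕋⁴ programme at fixed ε, Bałaban AS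
PRINTED — R4 closes the conditional finite-𝕋⁴ rung `BalabanLadder.UV` only; the Yang–Mills mass gap (Clay) is NOT proved by any of this; nothing continuum ∕ ℝ⁴ ∕ OS.  No `sorry`,
standard axioms.
-/

noncomputable section

open MeasureTheory
open scoped ENNReal

namespace Summit.QuantumFields.YangMills.BalabanUVNodes.N08PartialIteratesSufficiency

open Literature.MathematicalPhysics.QuantumFieldTheory.Balaban1983to89
open Summit.QuantumFields.Balaban3D.Carriers
open Summit.QuantumFields.Balaban3D.Proofs.MassesAC
open Summit.QuantumFields.YangMills.BalabanUVNodes.N08MassesACLeastClosedFamily (massRecAC_le_ae_of_weakClosed_real)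
open Summit.QuantumFields.YangMills.BalabanUVNodes.N08TrivialHistoryIteratedTransport (withDensity_rhoSeq_succ)

/-! ## §1 The partial iterated push-forwards -/
section Iterates

variable {P : Params} {G : Type} [GaugeGroup G] [MeasurableSpace G] [HaarData G]

/-- The push-forward of a finite sum of measures is the sum of the push-forwards (measurable map). [folklore] -/
theorem map_finset_sum {α β : Type*} [MeasurableSpace α] [MeasurableSpace β] {f : α → β} (hf : Measurable f) (s : Finset ℕ) (μ : ℕ → Measure α) :
    (∑ j ∈ s, μ j).map f = ∑ j ∈ s, (μ j).map f := by
  classical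
  induction s using Finset.induction_on with
  | empty => simp
  | insert a s ha ih => rw [Finset.sum_insert ha, Finset.sum_insert ha, Measure.map_add _ _ hf, ih]

/-- ★ **THE PARTIAL ITERATED PUSH-FORWARDS OF THE REFERENCE MEASURE EXIST**: a two-parameter family `ι_{j,k}` of measures on the level-`k` fields with `ι_{j,j} = dU_j` and
`ι_{j,k+1} = ι_{j,k}∘Ū_k⁻¹` for `j ≤ k` — i.e. `ι_{j,k} = (Ū_{k−1}∘⋯∘Ū_j)_*dU_j` ([Balaban1985UV3] (2) «ρ_{k+1} = Tρ_k» started at level `j` from the reference measure).  By recursion on the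
level; no definition introduced. [cite: Balaban1985UV3, (2) p.256 (bookkeeping)] -/
theorem exists_partialIterates (av : ∀ j, Averaging P j G) :
    ∃ ι : ∀ j k : ℕ, Measure (GaugeField P k G),
      (∀ j, ι j j = fieldMeasure P j G) ∧ (∀ j k, j ≤ k → ι j (k + 1) = (ι j k).map (av k).avg) := by
  classical
  refine ⟨fun j => fun k => Nat.rec (motive := fun k => Measure (GaugeField P k G)) (if j = 0 then fieldMeasure P 0 G else 0)
    (fun k μ => if j = k + 1 then fieldMeasure P (k + 1) G else μ.map (av k).avg) k, fun j => ?_, fun j k hjk => ?_⟩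
  · cases j with
    | zero => simp
    | succ n => simp
  · show (if j = k + 1 then fieldMeasure P (k + 1) G else _) = _
    rw [if_neg (by omega)]

/-- **The start-level-`0` member is file 25's iterated transported reference density as a measure**: `ι_{0,k} = (T_{k−1}⋯T_0 1)·dU_k` (under `AvgAC`; induction with file 25's
`withDensity_rhoSeq_succ`). [cite: Balaban1985UV3, (2) p.256 (bookkeeping)] -/
theorem partialIterates_zero_eq_withDensity_rhoSeq (av : ∀ j, Averaging P j G) (hav : ∀ j, AvgAC (av j).avg)
    (ι : ∀ j k : ℕ, Measure (GaugeField P k G)) (hι0 : ∀ j, ι j j = fieldMeasure P j G) (hιs : ∀ j k, j ≤ k → ι j (k + 1) = (ι j k).map (av k).avg) :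
    ∀ k, ι 0 k = (fieldMeasure P k G).withDensity (fun V => ENNReal.ofReal (rhoSeq av (fun _ => (1 : ℝ)) k V))
  | 0 => by
    have : (fun V => ENNReal.ofReal (rhoSeq av (fun _ => (1 : ℝ)) 0 V)) = fun _ => (1 : ℝ≥0∞) := by
      funext V; rw [rhoSeq_zero]; simp
    rw [hι0, this, withDensity_const, one_smul]
  | k + 1 => by
    rw [hιs 0 k (Nat.zero_le _), partialIterates_zero_eq_withDensity_rhoSeq av hav ι hι0 hιs k,
      withDensity_rhoSeq_succ av hav (fun _ => zero_le_one) (integrable_const _) k]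

end Iterates

/-! ## §2 Sufficiency up to `log(k+1)`: all partial iterates bounded ⇒ every mass bounded -/
section Sufficiency

variable {P : Params} {G : Type} [GaugeGroup G] [MeasurableSpace G] [HaarData G]
  (M₁ : ℕ) (Rcol : ℕ → ℕ) (εL εS : ℕ → ℝ) (av : ∀ j, Averaging P j G) (hav : ∀ j, AvgAC (av j).avg)
include hav

/-- ★★★ **(a)′∀ ⇒ THE UNIFORM LETTER UP TO THE FACTOR `k + 1`, FOR EVERY HISTORY**: let `ι_{j,k}` be the partial iterated push-forwards of the reference measure
(`ι_{j,j} = dU_j`, `ι_{j,k+1} = ι_{j,k}∘Ū_k⁻¹`).  If `ι_{j,k} ≤ C_k·dU_k` for all `j < k ≤ K̄` (`C_k ≥ 0`), then **`m_k(h,V) ≤ 1 + k·C_k` for `dU_k`-a.e. `V`**, every `k ≤ K̄`, every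
history `h` — the family `ν_k := Σ_{j<k} ι_{j,k}` is closed WITH EQUALITY under the one-step transport (`(dU_k + ν_k)∘Ū_k⁻¹ = ν_{k+1}`), so files 16∕17's reduction applies; the step
weights `ζχ ≤ 1` only help. [cite: Balaban1985UV3, (41) p.266 + (2) p.256 + (5) p.257 (the extensive shape; bookkeeping); Balaban1985Averaging, (15) p.19] -/
theorem massRecAC_le_ae_of_partialIterates_le (ι : ∀ j k : ℕ, Measure (GaugeField P k G)) (hι0 : ∀ j, ι j j = fieldMeasure P j G)
    (hιs : ∀ j k, j ≤ k → ι j (k + 1) = (ι j k).map (av k).avg) (Kt : ℕ) (C : ℕ → ℝ) (hC : ∀ k, 0 ≤ C k)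
    (hbound : ∀ j k, j < k → k ≤ Kt → ι j k ≤ ENNReal.ofReal (C k) • fieldMeasure P k G)
    (k : ℕ) (hk : k ≤ Kt) (h : Hist P k) :
    ∀ᵐ V ∂(fieldMeasure P k G), massRecAC M₁ Rcol εL εS av k h V ≤ 1 + k * C k := by
  -- the strongly closed family `ν_k = Σ_{j<k} ι_{j,k}`
  let ν : ∀ k, Measure (GaugeField P k G) := fun k => ∑ j ∈ Finset.range k, ι j k
  have hstep : ∀ k, (fieldMeasure P k G + ν k).map (av k).avg ≤ fieldMeasure P (k + 1) G + ν (k + 1) := by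
    intro k
    have heq : (fieldMeasure P k G + ν k).map (av k).avg = ν (k + 1) := by
      show (fieldMeasure P k G + ∑ j ∈ Finset.range k, ι j k).map (av k).avg = ∑ j ∈ Finset.range (k + 1), ι j (k + 1)
      rw [← hι0 k, ← Finset.sum_range_succ_comm (fun j => ι j k) k, map_finset_sum (hav k).1]
      refine Finset.sum_congr rfl fun j hj => ?_
      rw [hιs j k (by simpa [Nat.lt_succ_iff] using Finset.mem_range.1 hj)]
    rw [heq]
    exact Measure.le_add_left le_rfl
  -- its density bound `ν_k ≤ (k·C_k)·dU_k` on the range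
  have hνb : ∀ k, k ≤ Kt → ν k ≤ (fieldMeasure P k G).withDensity (fun _ => ENNReal.ofReal (k * C k)) := by
    intro k hkK
    rw [withDensity_const]
    show ∑ j ∈ Finset.range k, ι j k ≤ ENNReal.ofReal (k * C k) • fieldMeasure P k G
    calc ∑ j ∈ Finset.range k, ι j k ≤ ∑ j ∈ Finset.range k, ENNReal.ofReal (C k) • fieldMeasure P k G :=
          Finset.sum_le_sum fun j hj => hbound j k (Finset.mem_range.1 hj) hkK
      _ = ENNReal.ofReal (k * C k) • fieldMeasure P k G := by
          rw [Finset.sum_const, Finset.card_range, ← Nat.cast_smul_eq_nsmul ℝ≥0∞, smul_smul,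
            ENNReal.ofReal_mul (Nat.cast_nonneg k), ENNReal.ofReal_natCast]
  exact massRecAC_le_ae_of_weakClosed_real M₁ Rcol εL εS av hav Kt ν (fun k _ => hstep k) (fun k _ => k * C k)
    (fun k _ => mul_nonneg (Nat.cast_nonneg k) (hC k)) hνb k hk h

/-- ★★ **… in the extensive shape**: `ι_{j,k} ≤ e^{c_k}·dU_k` (`j < k ≤ K̄`) ⇒ `m_k(h,V) ≤ (k+1)·e^{c_k}` (`≤ exp(c_k + log(k+1))`) for `dU_k`-a.e. `V`, every history — the uniform letter
of file 15 ∕ III-b up to the factor `k + 1` (the floors of the (47)-term, one reference copy per level). [cite: Balaban1985UV3, (41) p.266 + (5) p.257 (bookkeeping)] -/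
theorem massRecAC_le_exp_mul_ae_of_partialIterates_le (ι : ∀ j k : ℕ, Measure (GaugeField P k G)) (hι0 : ∀ j, ι j j = fieldMeasure P j G)
    (hιs : ∀ j k, j ≤ k → ι j (k + 1) = (ι j k).map (av k).avg) (Kt : ℕ) (c : ℕ → ℝ) (hc : ∀ k, 0 ≤ c k)
    (hbound : ∀ j k, j < k → k ≤ Kt → ι j k ≤ ENNReal.ofReal (Real.exp (c k)) • fieldMeasure P k G)
    (k : ℕ) (hk : k ≤ Kt) (h : Hist P k) :
    ∀ᵐ V ∂(fieldMeasure P k G), massRecAC M₁ Rcol εL εS av k h V ≤ (k + 1) * Real.exp (c k) := by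
  filter_upwards [massRecAC_le_ae_of_partialIterates_le M₁ Rcol εL εS av hav ι hι0 hιs Kt (fun k => Real.exp (c k)) (fun k => (Real.exp_pos _).le)
    hbound k hk h] with V hV
  have h1 : (1 : ℝ) ≤ Real.exp (c k) := Real.one_le_exp (hc k)
  linarith

end Sufficiency

/-! ## §3 At the [B10] slot's averaging -/
section Print

open Literature.MathematicalPhysics.QuantumFieldTheory.Balaban1985CMP102.Setting (Scales)
open Literature.MathematicalPhysics.QuantumFieldTheory.Balaban1983to89.B10RunsOfRecord (avOfPrint)
open Literature.MathematicalPhysics.QuantumFieldTheory.Balaban1983to89.Node00 (SU)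
open Summit.QuantumFields.YangMills.BalabanUVNodes.N08Thm2AtRecordBridgeInhabited (avgAC_avOfPrint)
open Summit.QuantumFields.Balaban3D.Proofs.ScalesArithmetic (sites_nonneg)

variable (N : ℕ) [NeZero N] {L : ℕ} (S : Scales L) (M₁ : ℕ) (Rcol : ℕ → ℕ) (εL εS : ℕ → ℝ)

/-- ★★★ **AT PRINT'S AVERAGING: all partial iterated push-forwards of Haar under [Balaban1985Averaging] (15) bounded, `(Ū_{k−1}∘⋯∘Ū_j)_*dU_j ≤ e^{c_m|T₁^{(k)}|}·dU_k`
(`j < k ≤ K`), IMPLIES «`massRecAC M₁ Rcol ε_L ε_S (avOfPrint N S) k h ≤ (k+1)·e^{c_m|T₁^{(k)}|}` `dU_k`-a.e.», every history, every `k ≤ K`** — the uniform letter of III-b up to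
`log(k+1)`; with file 25's necessity the [B10] transport residual is bracketed by iterated-push-forward statements alone. [cite: Balaban1985UV3, (41) p.266 + (5) p.257; Balaban1985Averaging, (15) p.19] -/
theorem massRecAC_avOfPrint_le_ae_of_partialIterates_le (ι : ∀ j k : ℕ, Measure (GaugeField S.P k (SU N)))
    (hι0 : ∀ j, ι j j = fieldMeasure S.P j (SU N)) (hιs : ∀ j k, j ≤ k → ι j (k + 1) = (ι j k).map (avOfPrint N S k).avg) {cm : ℝ} (hcm : 0 ≤ cm)
    (hbound : ∀ j k, j < k → k ≤ S.K → ι j k ≤ ENNReal.ofReal (Real.exp (cm * S.sites k)) • fieldMeasure S.P k (SU N))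
    (k : ℕ) (hk : k ≤ S.K) (h : Hist S.P k) :
    ∀ᵐ V ∂(fieldMeasure S.P k (SU N)), massRecAC M₁ Rcol εL εS (avOfPrint N S) k h V ≤ (k + 1) * Real.exp (cm * S.sites k) :=
  massRecAC_le_exp_mul_ae_of_partialIterates_le M₁ Rcol εL εS (avOfPrint N S) (avgAC_avOfPrint N L S) ι hι0 hιs S.K (fun k => cm * S.sites k)
    (fun k => mul_nonneg hcm (sites_nonneg S k)) hbound k hk h

/-- The partial iterates of print's averaging exist (§1 instantiated) — so the hypothesis of `massRecAC_avOfPrint_le_ae_of_partialIterates_le` is about well-defined objects: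
the measures `(Ū_{k−1}∘⋯∘Ū_j)_*dU_j` along [Balaban1985Averaging] (15) on `SU(N)`. [cite: Balaban1985UV3, (2) p.256; Balaban1985Averaging, (15) p.19] -/
theorem exists_partialIterates_avOfPrint :
    ∃ ι : ∀ j k : ℕ, Measure (GaugeField S.P k (SU N)),
      (∀ j, ι j j = fieldMeasure S.P j (SU N)) ∧ (∀ j k, j ≤ k → ι j (k + 1) = (ι j k).map (avOfPrint N S k).avg) :=
  exists_partialIterates (avOfPrint N S)

end Print

end Summit.QuantumFields.YangMills.BalabanUVNodes.N08PartialIteratesSufficiency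

end
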